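import Literature.NumberTheory.EllipticCurves.IwasawaAlgebraProofs
import HarnessLib

/-!
# `μ` is additive in short exact sequences (discharge of `Literature.NumberTheory.EllipticCurves.muInvariant_add_of_shortExact`)

Sibling proof file of `IwasawaAlgebra.lean` (D-0014), importing `IwasawaAlgebraProofs.lean` (for
the additivity of local lengths `Literature.NumberTheory.EllipticCurves.Module.lengthAt_eq_add_of_exact`, the prime `(p)` of
`Λ = ℤ_[p]⟦T⟧` (`IwasawaAlgebra.isPrime_augIdealP_holds`), the description of `μ` as a local
length `Literature.NumberTheory.EllipticCurves.muInvariant_eq_toNat_lengthAt`, and its finiteness on finitely generated torsion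
modules `Literature.NumberTheory.EllipticCurves.lengthAt_ne_top_of_isTorsion`).  It discharges the named fact

* `Literature.muInvariant_add_of_shortExact p M` : for a short exact sequence `0 → M' → M → M'' → 0` of
  `Λ`-modules with `M` finitely generated torsion, `μ(M) = μ(M') + μ(M'')`,

as `Literature.NumberTheory.EllipticCurves.muInvariant_add_of_shortExact_holds`.  The file declares theorems only; the statement is
proved exactly as vendored (it is correctly stated: `M'` and `M''` are then automatically finitely
generated torsion, `Λ` being Noetherian).

## The printed statement

Washington, *Introduction to Cyclotomic Fields* (GTM 83), §13.2: the `μ`-invariant `μ = ∑ μᵢ` of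
a finitely generated torsion `Λ`-module `M ∼ ⨁ Λ/(p^{μᵢ}) ⊕ ⨁ Λ/(fⱼ^{mⱼ})` (after Thm. 13.12);
Greenberg, *Iwasawa theory for elliptic curves* (LNM 1716), §5, Remark following Cor. 5.5: for an
exact sequence `0 → X₁ → X₂ → X₃ → 0` of finitely generated torsion `Λ`-modules the characteristic
ideal is multiplicative and "Both `λ` and `μ` are additive"; Neukirch–Schmidt–Wingberg,
*Cohomology of Number Fields*, Ch. V §3, Remark 2 after (5.3.9): "The invariants `μ(M)` and `λ(M)`
are additive … in short exact sequences of finitely generated `Λ`-torsion modules."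

## The proof

This is the `𝔭 = (p)` component of the multiplicativity of the characteristic ideal
(Bourbaki AC VII §4.5 Prop. 10; `Literature.NumberTheory.EllipticCurves.Module.charIdeal_eq_mul_of_exact` in
`IwasawaAlgebraProofs.lean`).  In `IwasawaAlgebra.lean`, `μ(N)` is the finite sum over the primes
`𝔭` with `𝔭 = (p)` of `(length_{Λ_𝔭} N_𝔭).toNat`, i.e. `μ(N) = (length_{Λ_(p)} N_(p)).toNat`
(`Literature.NumberTheory.EllipticCurves.muInvariant_eq_toNat_lengthAt`, `(p)` being prime).  Localisation at `(p)` is exact and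
`Module.length` is additive, so `length M_(p) = length M'_(p) + length M''_(p)` in `ℕ∞`
(`Literature.NumberTheory.EllipticCurves.Module.lengthAt_eq_add_of_exact`).  Finally all three lengths are finite: `M' ↪ M` and
`M ↠ M''` are, with `M`, finitely generated (`Λ` is Noetherian) and torsion, and `(p)` has height
one, so `Literature.NumberTheory.EllipticCurves.lengthAt_ne_top_of_isTorsion` applies; hence `ENat.toNat` is additive on them.

## References

* L. C. Washington, *Introduction to Cyclotomic Fields*, 2nd ed., GTM 83, Springer 1997, §13.2.
* R. Greenberg, *Iwasawa theory for elliptic curves*, in: Arithmetic Theory of Elliptic Curves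
  (Cetraro 1997), LNM 1716, Springer 1999, 51–144; §5, Remark following Cor. 5.5.
* J. Neukirch, A. Schmidt, K. Wingberg, *Cohomology of Number Fields*, 2nd ed., Grundlehren 323,
  Springer 2008; Ch. V §3, Remark 2 after (5.3.9).
* N. Bourbaki, *Algèbre commutative*, Ch. VII §4.5 Prop. 10.
-/

noncomputable section

namespace Literature.NumberTheory.EllipticCurves

section MuAdditive

open IwasawaAlgebra

variable (p : ℕ) [Fact p.Prime]

/-- A submodule of a torsion module is torsion: if `f : M' → M` is injective and `M` is torsion
then so is `M'`. [folklore] -/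
theorem isTorsion_of_injective {R : Type*} [CommRing R] {M M' : Type*} [AddCommGroup M]
    [_root_.Module R M] [AddCommGroup M'] [_root_.Module R M'] (f : M' →ₗ[R] M)
    (hf : Function.Injective f) (hM : Module.IsTorsion R M) : Module.IsTorsion R M' := by
  intro x
  obtain ⟨a, ha⟩ := @hM (f x)
  refine ⟨a, hf ?_⟩
  rw [Submonoid.smul_def, map_smul, map_zero, ← Submonoid.smul_def, ha]

/-- A quotient of a torsion module is torsion: if `g : M → M''` is surjective and `M` is torsion
then so is `M''`. [folklore] -/
theorem isTorsion_of_surjective {R : Type*} [CommRing R] {M M'' : Type*} [AddCommGroup M]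
    [_root_.Module R M] [AddCommGroup M''] [_root_.Module R M''] (g : M →ₗ[R] M'')
    (hg : Function.Surjective g) (hM : Module.IsTorsion R M) : Module.IsTorsion R M'' := by
  intro x
  obtain ⟨y, rfl⟩ := hg x
  obtain ⟨a, ha⟩ := @hM y
  refine ⟨a, ?_⟩
  rw [Submonoid.smul_def, ← map_smul, ← Submonoid.smul_def, ha, map_zero]

variable (M : Type*) [AddCommGroup M] [Module (IwasawaAlgebra p) M]

/-- **Discharge of the named fact `Literature.NumberTheory.EllipticCurves.muInvariant_add_of_shortExact`: `μ` is additive in short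
exact sequences.** For a short exact sequence `0 → M' → M → M'' → 0` of `Λ = ℤ_[p]⟦T⟧`-modules
with `M` finitely generated torsion, `μ(M) = μ(M') + μ(M'')`
(Washington, *Introduction to Cyclotomic Fields*, §13.2; Greenberg, LNM 1716, §5, Remark after
Cor. 5.5: "Both `λ` and `μ` are additive"; NSW Ch. V §3, Remark 2 after (5.3.9)).  Proof:
`μ = length_{Λ_(p)} (–)_(p)` as a natural number, localisation at the height-one prime `(p)` is
exact, `Module.length` is additive, and the three local lengths are finite.
[cite: Washington1997, §13.2; GreenbergLNM1716, §5 (Remark following Cor. 5.5);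
NeukirchSchmidtWingberg2008, Ch. V §3, Remark 2 after (5.3.9)] -/
theorem muInvariant_add_of_shortExact_holds : muInvariant_add_of_shortExact p M := by
  intro _ hM M' M'' _ _ _ _ f g hf hg hfg
  haveI : IsNoetherian (IwasawaAlgebra p) M := isNoetherian_of_isNoetherianRing_of_finite _ M
  haveI : Module.Finite (IwasawaAlgebra p) M' := Module.Finite.of_injective f hf
  haveI : Module.Finite (IwasawaAlgebra p) M'' := Module.Finite.of_surjective g hg
  have hM' : Module.IsTorsion (IwasawaAlgebra p) M' := isTorsion_of_injective f hf hM
  have hM'' : Module.IsTorsion (IwasawaAlgebra p) M'' := isTorsion_of_surjective g hg hM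
  let 𝔭 : PrimeSpectrum (IwasawaAlgebra p) := ⟨augIdealP p, isPrime_augIdealP_holds p⟩
  rw [muInvariant_eq_toNat_lengthAt p M 𝔭 rfl, muInvariant_eq_toNat_lengthAt p M' 𝔭 rfl,
    muInvariant_eq_toNat_lengthAt p M'' 𝔭 rfl, Module.lengthAt_eq_add_of_exact f g hf hg hfg 𝔭,
    ENat.toNat_add (lengthAt_ne_top_of_isTorsion p M' hM' 𝔭 rfl)
      (lengthAt_ne_top_of_isTorsion p M'' hM'' 𝔭 rfl)]

end MuAdditive

end Literature.NumberTheory.EllipticCurves
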